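import Mathlib
import HarnessLib
import Summits.QuantumFields.YangMills.Theorems.LangevinControlUVFemtoCurvatureSkewnessCycleKernelBasics
import Summits.QuantumFields.YangMills.Theorems.LangevinControlUVFemtoCurvatureSkewnessCycleKernelBounds

/-!
# Tree-level ratio floor — heat-kernel representation and the diagonal lower bound

Helper for stub `stub_treeRatioFloor` (crux stmt-QuantumFields-9365, line coupling-cubic-response).
For the diagonal displacement `y_d = n(e₃ - e₂)` the transverse propagator
`F(y_d) = ∑_{k ≠ 0} (ε₀+ε₁)/(ε₀+ε₁+ε₂+ε₃) cos(2π(k₃-k₂)n/L)` has the heat-kernel representation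
`F(y_d) = 2L⁴ ∫₀^∞ w(s) q(s,0) q(s,n)² ds` (`1/ε = ∫₀^∞ e^{-sε} ds` mode by mode, the 4-fold mode sum of the
product kernel factorises, the sine parts cancel), with the cycle heat kernel `q` and weight `w` of
`…CycleKernelBasics`.  The integrand is non-negative, so `F(y_d) ≥ 2L⁴ ∫_{K₀n²}^{2K₀n²} w q(·,0) q(·,n)²`, and on
that window the Fourier-side bounds of `…CycleKernelBounds` (`w ≥ c_w s^{-3/2}`, `q(s,0) ≥ c_a s^{-1/2}`,
`q(s,0) - q(s,n) ≤ C_d n² s^{-3/2} ≤ q(s,0)/2`) give `F(y_d) ≥ c L⁴/n⁴` (`diagSum_ge`, registered helper stub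
`TreeDiagPropagatorFloor`).  No positivity of the heat kernel is needed.
-/

noncomputable section

namespace Summit.QuantumFields.YangMills.Theorems.FemtoCurvatureSkewness

open Finset MeasureTheory Set
open scoped BigOperators

namespace CycleKernel

variable {L : ℕ} [NeZero L]

/-! ## Factorisation of the four-fold mode sum -/

omit [NeZero L] in
/-- `∑_{k ∈ (ZMod L)⁴} g₀(k₀) g₁(k₁) g₂(k₂) g₃(k₃) = (∑ g₀)(∑ g₁)(∑ g₂)(∑ g₃)`. -/
theorem sum_prod_four [NeZero L] (g₀ g₁ g₂ g₃ : ZMod L → ℝ) :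
    ∑ k : Fin 4 → ZMod L, g₀ (k 0) * g₁ (k 1) * g₂ (k 2) * g₃ (k 3) =
      (∑ a, g₀ a) * (∑ a, g₁ a) * (∑ a, g₂ a) * (∑ a, g₃ a) := by
  have h := (Fintype.prod_sum (fun (i : Fin 4) (a : ZMod L) =>
    (![g₀, g₁, g₂, g₃] : Fin 4 → ZMod L → ℝ) i a)).symm
  simp only [Fin.prod_univ_four] at h
  simpa using h

section Kernel

variable {ε : ZMod L → ℝ} {q : ℝ → ZMod L → ℝ} {w : ℝ → ℝ}

/-- The total dispersion of a non-zero mode is positive. -/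
theorem eps_total_pos (hε : ∀ k, ε k = 2 - 2 * Real.cos (2 * Real.pi * (k.val : ℝ) / L))
    {k : Fin 4 → ZMod L} (hk : k ≠ 0) : 0 < ε (k 0) + ε (k 1) + ε (k 2) + ε (k 3) := by
  have hL : (0 : ℝ) < L := by exact_mod_cast NeZero.pos L
  have h0 : ∀ i, 0 ≤ ε (k i) := fun i => by rw [hε]; exact eps_nonneg _
  have hpos : ∀ i, k i ≠ 0 → 0 < ε (k i) := by
    intro i hi
    rw [hε]
    refine lt_of_lt_of_le ?_ (sq_le_eps (k i))
    have : (1 : ℝ) ≤ (k i).valMinAbs.natAbs := by exact_mod_cast one_le_fold hi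
    positivity
  obtain ⟨i, hi⟩ : ∃ i, k i ≠ 0 := by
    by_contra h
    push Not at h
    exact hk (funext h)
  have hle : ε (k i) ≤ ε (k 0) + ε (k 1) + ε (k 2) + ε (k 3) := by
    have := Finset.single_le_sum (f := fun j => ε (k j)) (fun j _ => h0 j) (Finset.mem_univ i)
    simpa [Fin.sum_univ_four] using this
  linarith [hpos i hi]

/-- **Pointwise factorisation of the diagonal mode sum**: for every `s`,
`∑_k ε(k_i) e^{-s ε_tot(k)} cos(2π(k₃-k₂)n/L) = L⁴ w(s) q(s,0) q(s,n)²` for `i = 0` and `i = 1`. -/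
theorem diag_mode_sum (hε : ∀ k, ε k = 2 - 2 * Real.cos (2 * Real.pi * (k.val : ℝ) / L))
    (hq : ∀ s m, q s m = (∑ k : ZMod L, Real.exp (-(s * ε k)) *
      Real.cos (2 * Real.pi * (k.val : ℝ) * (m.val : ℝ) / L)) / L)
    (hw : ∀ s, w s = (∑ k : ZMod L, ε k * Real.exp (-(s * ε k))) / L) (s : ℝ) {n : ℕ} (hn : n < L) :
    (∑ k : Fin 4 → ZMod L, ε (k 0) * Real.exp (-(s * (ε (k 0) + ε (k 1) + ε (k 2) + ε (k 3)))) *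
        Real.cos (2 * Real.pi * (((k 3).val : ℝ) - ((k 2).val : ℝ)) * n / L) =
      (L : ℝ) ^ 4 * (w s * q s 0 * q s (n : ZMod L) ^ 2)) ∧
    (∑ k : Fin 4 → ZMod L, ε (k 1) * Real.exp (-(s * (ε (k 0) + ε (k 1) + ε (k 2) + ε (k 3)))) *
        Real.cos (2 * Real.pi * (((k 3).val : ℝ) - ((k 2).val : ℝ)) * n / L) =
      (L : ℝ) ^ 4 * (w s * q s 0 * q s (n : ZMod L) ^ 2)) := by
  have hL : (L : ℝ) ≠ 0 := Nat.cast_ne_zero.mpr (NeZero.ne L)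
  -- the one-dimensional sums
  set E : ZMod L → ℝ := fun a => Real.exp (-(s * ε a)) with hE
  set C : ZMod L → ℝ := fun a => Real.exp (-(s * ε a)) * Real.cos (2 * Real.pi * (a.val : ℝ) * n / L) with hC
  set S : ZMod L → ℝ := fun a => Real.exp (-(s * ε a)) * Real.sin (2 * Real.pi * (a.val : ℝ) * n / L) with hS
  set W : ZMod L → ℝ := fun a => ε a * Real.exp (-(s * ε a)) with hW
  have hSsum : ∑ a, S a = 0 := by
    have h := sum_exp_mul_sin hε s (n : ℤ)
    simp only [hS]
    exact_mod_cast h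
  have hEq : ∑ a, E a = L * q s 0 := by
    rw [q_zero hq, mul_div_cancel₀ _ hL]
  have hCq : ∑ a, C a = L * q s (n : ZMod L) := by
    rw [hq, ZMod.val_cast_of_lt hn, mul_div_cancel₀ _ hL]
  have hWw : ∑ a, W a = L * w s := by
    rw [hw, mul_div_cancel₀ _ hL]
  -- expand the summands
  have hexp : ∀ k : Fin 4 → ZMod L, Real.exp (-(s * (ε (k 0) + ε (k 1) + ε (k 2) + ε (k 3)))) =
      E (k 0) * E (k 1) * E (k 2) * E (k 3) := by
    intro k; simp only [hE, ← Real.exp_add]; ring_nf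
  have hcos : ∀ k : Fin 4 → ZMod L, Real.cos (2 * Real.pi * (((k 3).val : ℝ) - ((k 2).val : ℝ)) * n / L) =
      Real.cos (2 * Real.pi * ((k 2).val : ℝ) * n / L) * Real.cos (2 * Real.pi * ((k 3).val : ℝ) * n / L) +
      Real.sin (2 * Real.pi * ((k 2).val : ℝ) * n / L) * Real.sin (2 * Real.pi * ((k 3).val : ℝ) * n / L) := by
    intro k
    rw [show 2 * Real.pi * (((k 3).val : ℝ) - ((k 2).val : ℝ)) * n / L =
      2 * Real.pi * ((k 3).val : ℝ) * n / L - 2 * Real.pi * ((k 2).val : ℝ) * n / L by ring, Real.cos_sub]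
    ring
  refine ⟨?_, ?_⟩
  · calc ∑ k : Fin 4 → ZMod L, ε (k 0) * Real.exp (-(s * (ε (k 0) + ε (k 1) + ε (k 2) + ε (k 3)))) *
          Real.cos (2 * Real.pi * (((k 3).val : ℝ) - ((k 2).val : ℝ)) * n / L)
        = ∑ k : Fin 4 → ZMod L, (W (k 0) * E (k 1) * C (k 2) * C (k 3) + W (k 0) * E (k 1) * S (k 2) * S (k 3)) := by
          refine Finset.sum_congr rfl fun k _ => ?_
          rw [hexp, hcos]
          simp only [hW, hE, hC, hS]
          ring
      _ = (∑ a, W a) * (∑ a, E a) * (∑ a, C a) * (∑ a, C a) + (∑ a, W a) * (∑ a, E a) * (∑ a, S a) * (∑ a, S a) := by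
          rw [Finset.sum_add_distrib, sum_prod_four, sum_prod_four]
      _ = (L : ℝ) ^ 4 * (w s * q s 0 * q s (n : ZMod L) ^ 2) := by
          rw [hSsum, hEq, hCq, hWw]; ring
  · calc ∑ k : Fin 4 → ZMod L, ε (k 1) * Real.exp (-(s * (ε (k 0) + ε (k 1) + ε (k 2) + ε (k 3)))) *
          Real.cos (2 * Real.pi * (((k 3).val : ℝ) - ((k 2).val : ℝ)) * n / L)
        = ∑ k : Fin 4 → ZMod L, (E (k 0) * W (k 1) * C (k 2) * C (k 3) + E (k 0) * W (k 1) * S (k 2) * S (k 3)) := by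
          refine Finset.sum_congr rfl fun k _ => ?_
          rw [hexp, hcos]
          simp only [hW, hE, hC, hS]
          ring
      _ = (∑ a, E a) * (∑ a, W a) * (∑ a, C a) * (∑ a, C a) + (∑ a, E a) * (∑ a, W a) * (∑ a, S a) * (∑ a, S a) := by
          rw [Finset.sum_add_distrib, sum_prod_four, sum_prod_four]
      _ = (L : ℝ) ^ 4 * (w s * q s 0 * q s (n : ZMod L) ^ 2) := by
          rw [hSsum, hEq, hCq, hWw]; ring

/-- **Heat-kernel representation of the diagonal propagator**:
`∑_{k ≠ 0} (ε₀+ε₁)/(ε₀+…+ε₃) cos(2π(k₃-k₂)n/L) = 2L⁴ ∫₀^∞ w(s) q(s,0) q(s,n)² ds`. -/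
theorem diagSum_eq_integral (hε : ∀ k, ε k = 2 - 2 * Real.cos (2 * Real.pi * (k.val : ℝ) / L))
    (hq : ∀ s m, q s m = (∑ k : ZMod L, Real.exp (-(s * ε k)) *
      Real.cos (2 * Real.pi * (k.val : ℝ) * (m.val : ℝ) / L)) / L)
    (hw : ∀ s, w s = (∑ k : ZMod L, ε k * Real.exp (-(s * ε k))) / L) {n : ℕ} (hn : n < L) :
    ∑ k : Fin 4 → ZMod L,
      (if k = 0 then 0 else (ε (k 0) + ε (k 1)) / (ε (k 0) + ε (k 1) + ε (k 2) + ε (k 3))) *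
        Real.cos (2 * Real.pi * (((k 3).val : ℝ) - ((k 2).val : ℝ)) * n / L) =
      2 * (L : ℝ) ^ 4 * ∫ s in Ioi (0 : ℝ), w s * q s 0 * q s (n : ZMod L) ^ 2 := by
  have hε0 : ε 0 = 0 := by rw [hε]; simp
  -- mode by mode: `1/ε_tot = ∫₀^∞ e^{-s ε_tot} ds`
  set T : (Fin 4 → ZMod L) → ℝ := fun k => ε (k 0) + ε (k 1) + ε (k 2) + ε (k 3) with hT
  set φ : (Fin 4 → ZMod L) → ℝ := fun k => Real.cos (2 * Real.pi * (((k 3).val : ℝ) - ((k 2).val : ℝ)) * n / L)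
    with hφ
  have hint : ∀ k : Fin 4 → ZMod L, k ≠ 0 → ∫ s in Ioi (0 : ℝ), Real.exp (-(s * T k)) = 1 / T k := by
    intro k hk
    have hTk : 0 < T k := eps_total_pos hε hk
    have h := integral_exp_mul_Ioi (a := -T k) (by linarith) 0
    have e : (fun s : ℝ => Real.exp (-(s * T k))) = fun s => Real.exp (-T k * s) := by
      funext s; ring_nf
    rw [e, h]
    simp only [mul_zero, Real.exp_zero]
    field_simp
  have hterm : ∀ k : Fin 4 → ZMod L,
      (if k = 0 then 0 else (ε (k 0) + ε (k 1)) / T k) * φ k =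
        (∫ s in Ioi (0 : ℝ), ε (k 0) * Real.exp (-(s * T k)) * φ k) +
          ∫ s in Ioi (0 : ℝ), ε (k 1) * Real.exp (-(s * T k)) * φ k := by
    intro k
    by_cases hk : k = 0
    · subst hk
      simp [hε0]
    · rw [if_neg hk]
      have e1 : ∀ c : ℝ, (∫ s in Ioi (0 : ℝ), c * Real.exp (-(s * T k)) * φ k) =
          c * φ k * ∫ s in Ioi (0 : ℝ), Real.exp (-(s * T k)) := by
        intro c
        rw [← integral_const_mul]
        congr 1
        funext s
        ring
      rw [e1, e1, hint k hk]
      have hTk : 0 < T k := eps_total_pos hε hk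
      field_simp
  -- integrability of every mode on `(0, ∞)`
  have hmode : ∀ (i : Fin 4) (k : Fin 4 → ZMod L),
      Integrable (fun s : ℝ => ε (k i) * Real.exp (-(s * T k)) * φ k) (volume.restrict (Ioi 0)) := by
    intro i k
    by_cases hk : k = 0
    · subst hk
      have : (fun s : ℝ => ε ((0 : Fin 4 → ZMod L) i) * Real.exp (-(s * T 0)) * φ 0) = fun _ => 0 := by
        funext s; simp [hε0]
      rw [this]
      exact integrable_zero _ _ _
    · have hTk : 0 < T k := eps_total_pos hε hk
      have h1 : IntegrableOn (fun s : ℝ => Real.exp (-T k * s)) (Ioi 0) := exp_neg_integrableOn_Ioi 0 hTk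
      have h2 := (h1.const_mul (ε (k i))).mul_const (φ k)
      refine h2.congr (ae_of_all _ fun s => ?_)
      simp only
      ring_nf
  calc ∑ k : Fin 4 → ZMod L, (if k = 0 then 0 else (ε (k 0) + ε (k 1)) / T k) * φ k
      = ∑ k : Fin 4 → ZMod L, ((∫ s in Ioi (0 : ℝ), ε (k 0) * Real.exp (-(s * T k)) * φ k) +
          ∫ s in Ioi (0 : ℝ), ε (k 1) * Real.exp (-(s * T k)) * φ k) := Finset.sum_congr rfl fun k _ => hterm k
    _ = (∫ s in Ioi (0 : ℝ), ∑ k : Fin 4 → ZMod L, ε (k 0) * Real.exp (-(s * T k)) * φ k) +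
          ∫ s in Ioi (0 : ℝ), ∑ k : Fin 4 → ZMod L, ε (k 1) * Real.exp (-(s * T k)) * φ k := by
        rw [Finset.sum_add_distrib, integral_finsetSum _ (fun k _ => hmode 0 k),
          integral_finsetSum _ (fun k _ => hmode 1 k)]
    _ = (∫ s in Ioi (0 : ℝ), (L : ℝ) ^ 4 * (w s * q s 0 * q s (n : ZMod L) ^ 2)) +
          ∫ s in Ioi (0 : ℝ), (L : ℝ) ^ 4 * (w s * q s 0 * q s (n : ZMod L) ^ 2) := by
        congr 1
        · refine setIntegral_congr_fun measurableSet_Ioi fun s _ => ?_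
          exact (diag_mode_sum hε hq hw s hn).1
        · refine setIntegral_congr_fun measurableSet_Ioi fun s _ => ?_
          exact (diag_mode_sum hε hq hw s hn).2
    _ = 2 * (L : ℝ) ^ 4 * ∫ s in Ioi (0 : ℝ), w s * q s 0 * q s (n : ZMod L) ^ 2 := by
        rw [integral_const_mul]
        ring

/-- The integrand `w q(·,0) q(·,n)²` is integrable on `(0, ∞)`: it is continuous and dominated by
`w ≤ 4 e^{-16 s/L²}` (as `|q| ≤ 1`). -/
theorem integrableOn_wqq (hε : ∀ k, ε k = 2 - 2 * Real.cos (2 * Real.pi * (k.val : ℝ) / L))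
    (hq : ∀ s m, q s m = (∑ k : ZMod L, Real.exp (-(s * ε k)) *
      Real.cos (2 * Real.pi * (k.val : ℝ) * (m.val : ℝ) / L)) / L)
    (hw : ∀ s, w s = (∑ k : ZMod L, ε k * Real.exp (-(s * ε k))) / L) (m : ZMod L) :
    IntegrableOn (fun s : ℝ => w s * q s 0 * q s m ^ 2) (Ioi 0) := by
  have hL : (0 : ℝ) < L := by exact_mod_cast NeZero.pos L
  have hcont : Continuous fun s : ℝ => w s * q s 0 * q s m ^ 2 :=
    ((continuous_w hw).mul (continuous_q hq 0)).mul ((continuous_q hq m).pow 2)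
  have hb : 0 < 16 / (L : ℝ) ^ 2 := by positivity
  have hdom : IntegrableOn (fun s : ℝ => 4 * Real.exp (-(16 / (L : ℝ) ^ 2) * s)) (Ioi 0) :=
    (exp_neg_integrableOn_Ioi 0 hb).const_mul 4
  refine Integrable.mono' hdom hcont.aestronglyMeasurable ?_
  refine (ae_restrict_iff' measurableSet_Ioi).mpr (ae_of_all _ fun s (hs : 0 < s) => ?_)
  have hw0 : 0 ≤ w s := w_nonneg hε hw s
  have hq0 : 0 ≤ q s 0 := le_trans (by positivity) (inv_le_q_zero hε hq s)
  have hq1 : q s 0 ≤ 1 := q_zero_le_one hε hq hs.le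
  have hqm : |q s m| ≤ 1 := (abs_q_le hq s m).trans hq1
  have hqm2 : q s m ^ 2 ≤ 1 := by
    have := abs_le.mp hqm
    nlinarith
  rw [Real.norm_eq_abs, abs_mul, abs_mul, abs_of_nonneg hw0, abs_of_nonneg hq0, abs_of_nonneg (sq_nonneg _)]
  calc w s * q s 0 * q s m ^ 2 ≤ w s * 1 * 1 := by gcongr
    _ = w s := by ring
    _ ≤ 4 * Real.exp (-(16 * s / (L : ℝ) ^ 2)) := w_le_exp hε hw hs.le
    _ = 4 * Real.exp (-(16 / (L : ℝ) ^ 2) * s) := by ring_nf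

/-! ## The window lower bound -/

/-- **Window lower bound.** With `c_a = e⁻¹/(2π)`, `C_d = π²√(2π)/16`, `K₀ = 2C_d/c_a + 1` and
`c_w = min((12eπ³)⁻¹, 2e^{-4π²K₀/32}/π³)`: for `1 ≤ n`, `8n ≤ L`,
`∫₀^∞ w q(·,0) q(·,n)² ≥ c_w c_a³/(32 K₀² n⁴)` (restrict to the window `[K₀n², 2K₀n²]`, where
`w ≥ c_w s^{-3/2}`, `q(s,0) ≥ c_a s^{-1/2}` and `q(s,n) ≥ q(s,0)/2`). -/
theorem integral_wqq_ge (hε : ∀ k, ε k = 2 - 2 * Real.cos (2 * Real.pi * (k.val : ℝ) / L))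
    (hq : ∀ s m, q s m = (∑ k : ZMod L, Real.exp (-(s * ε k)) *
      Real.cos (2 * Real.pi * (k.val : ℝ) * (m.val : ℝ) / L)) / L)
    (hw : ∀ s, w s = (∑ k : ZMod L, ε k * Real.exp (-(s * ε k))) / L) {n : ℕ} (hn : 1 ≤ n) (hnL : 8 * n ≤ L) :
    min (1 / (12 * Real.exp 1 * Real.pi ^ 3)) (2 * Real.exp (-(4 * Real.pi ^ 2 *
        ((2 * (Real.pi ^ 2 * Real.sqrt (2 * Real.pi) / 16) / (Real.exp (-1) / (2 * Real.pi)) + 1) / 32))) / Real.pi ^ 3) *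
      (Real.exp (-1) / (2 * Real.pi)) ^ 3 /
      (32 * (2 * (Real.pi ^ 2 * Real.sqrt (2 * Real.pi) / 16) / (Real.exp (-1) / (2 * Real.pi)) + 1) ^ 2 * (n : ℝ) ^ 4) ≤
      ∫ s in Ioi (0 : ℝ), w s * q s 0 * q s (n : ZMod L) ^ 2 := by
  have hL : (0 : ℝ) < L := by exact_mod_cast NeZero.pos L
  have hL2 : 2 ≤ L := by omega
  have hnL' : n < L := by omega
  have hn1 : (1 : ℝ) ≤ n := by exact_mod_cast hn
  have hn8 : 8 * (n : ℝ) ≤ L := by exact_mod_cast hnL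
  -- the constants
  set c_a : ℝ := Real.exp (-1) / (2 * Real.pi) with hca
  set C_d : ℝ := Real.pi ^ 2 * Real.sqrt (2 * Real.pi) / 16 with hCd
  set K₀ : ℝ := 2 * C_d / c_a + 1 with hK0
  set c_w : ℝ := min (1 / (12 * Real.exp 1 * Real.pi ^ 3)) (2 * Real.exp (-(4 * Real.pi ^ 2 * (K₀ / 32))) / Real.pi ^ 3)
    with hcw
  have hca0 : 0 < c_a := by positivity
  have hCd0 : 0 < C_d := by positivity
  have hK01 : 1 ≤ K₀ := by
    have : 0 ≤ 2 * C_d / c_a := by positivity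
    rw [hK0]; linarith
  have hK00 : 0 < K₀ := by linarith
  have hcw0 : 0 < c_w := lt_min (by positivity) (by positivity)
  set s₀ : ℝ := K₀ * (n : ℝ) ^ 2 with hs0
  have hn2 : (1 : ℝ) ≤ (n : ℝ) ^ 2 := by nlinarith
  have hs01 : 1 ≤ s₀ := by rw [hs0]; nlinarith
  have hs00 : 0 < s₀ := by linarith
  set f : ℝ → ℝ := fun s => w s * q s 0 * q s (n : ZMod L) ^ 2 with hf
  -- pointwise lower bound on the window
  have hwin : ∀ s ∈ Icc s₀ (2 * s₀), c_w * c_a ^ 3 / (32 * s₀ ^ 3) ≤ f s := by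
    intro s hs
    obtain ⟨hs1, hs2⟩ := hs
    have hs_1 : 1 ≤ s := le_trans hs01 hs1
    have hs_0 : 0 < s := by linarith
    have hsp : 0 < Real.sqrt s := Real.sqrt_pos.mpr hs_0
    have hsK : s ≤ K₀ / 32 * (L : ℝ) ^ 2 := by
      have : (n : ℝ) ^ 2 ≤ (L : ℝ) ^ 2 / 64 := by nlinarith
      calc s ≤ 2 * s₀ := hs2
        _ = 2 * K₀ * (n : ℝ) ^ 2 := by rw [hs0]; ring
        _ ≤ 2 * K₀ * ((L : ℝ) ^ 2 / 64) := by gcongr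
        _ = K₀ / 32 * (L : ℝ) ^ 2 := by ring
    have hw_lb : c_w / (s * Real.sqrt s) ≤ w s := le_w hε hw hL2 hs_1 hsK
    have ha_lb : c_a / Real.sqrt s ≤ q s 0 := by
      have h := le_q_zero hε hq hs_1
      rw [hca, div_div]
      exact h
    have hgap : q s 0 - q s (n : ZMod L) ≤ C_d * (n : ℝ) ^ 2 / (s * Real.sqrt s) := q_zero_sub_q_le hε hq hs_0 hnL'
    -- `C_d n²/(s√s) ≤ (c_a/√s)/2` because `s ≥ K₀ n² ≥ (2 C_d/c_a) n²`
    have hgap2 : C_d * (n : ℝ) ^ 2 / (s * Real.sqrt s) ≤ c_a / Real.sqrt s / 2 := by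
      have h1 : 2 * C_d / c_a * (n : ℝ) ^ 2 ≤ s := by
        calc 2 * C_d / c_a * (n : ℝ) ^ 2 ≤ K₀ * (n : ℝ) ^ 2 := by gcongr; rw [hK0]; linarith
          _ = s₀ := by rw [hs0]
          _ ≤ s := hs1
      have h2 : C_d * (n : ℝ) ^ 2 ≤ c_a / 2 * s := by
        have := mul_le_mul_of_nonneg_left h1 (by positivity : (0 : ℝ) ≤ c_a / 2)
        calc C_d * (n : ℝ) ^ 2 = c_a / 2 * (2 * C_d / c_a * (n : ℝ) ^ 2) := by field_simp
          _ ≤ c_a / 2 * s := this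
      rw [div_le_iff₀ (by positivity)]
      calc C_d * (n : ℝ) ^ 2 ≤ c_a / 2 * s := h2
        _ = c_a / Real.sqrt s / 2 * (s * Real.sqrt s) := by field_simp
    have hq0 : 0 ≤ q s 0 := le_trans (by positivity) ha_lb
    have hqn : q s 0 / 2 ≤ q s (n : ZMod L) := by linarith
    have hqn' : c_a / Real.sqrt s / 2 ≤ q s (n : ZMod L) := by linarith
    have hca2 : 0 ≤ c_a / Real.sqrt s / 2 := by positivity
    have hsq : (c_a / Real.sqrt s / 2) ^ 2 ≤ q s (n : ZMod L) ^ 2 := pow_le_pow_left₀ hca2 hqn' 2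
    have hss : Real.sqrt s * Real.sqrt s = s := Real.mul_self_sqrt hs_0.le
    calc c_w * c_a ^ 3 / (32 * s₀ ^ 3) ≤ c_w * c_a ^ 3 / (4 * s ^ 3) := by
          rw [div_le_div_iff₀ (by positivity) (by positivity)]
          have : s ^ 3 ≤ (2 * s₀) ^ 3 := pow_le_pow_left₀ hs_0.le hs2 3
          nlinarith [mul_pos hcw0 (pow_pos hca0 3)]
      _ = (c_w / (s * Real.sqrt s)) * (c_a / Real.sqrt s) * (c_a / Real.sqrt s / 2) ^ 2 := by
          generalize ht : Real.sqrt s = t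
          have ht0 : 0 < t := by rw [← ht]; exact hsp
          have hts : s = t ^ 2 := by rw [← ht, Real.sq_sqrt hs_0.le]
          rw [hts]
          field_simp
          ring
      _ ≤ w s * q s 0 * q s (n : ZMod L) ^ 2 := by
          have h1 : (c_w / (s * Real.sqrt s)) * (c_a / Real.sqrt s) ≤ w s * q s 0 :=
            mul_le_mul hw_lb ha_lb (by positivity) (w_nonneg hε hw s)
          exact mul_le_mul h1 hsq (by positivity) (mul_nonneg (w_nonneg hε hw s) hq0)
  -- restrict the integral to the window
  have hint : IntegrableOn f (Ioi 0) := integrableOn_wqq hε hq hw (n : ZMod L)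
  have hnonneg : ∀ s, 0 ≤ f s := fun s =>
    mul_nonneg (mul_nonneg (w_nonneg hε hw s) (le_trans (by positivity) (inv_le_q_zero hε hq s))) (sq_nonneg _)
  have hsub : Icc s₀ (2 * s₀) ⊆ Ioi 0 := fun s hs => lt_of_lt_of_le hs00 hs.1
  have h1 : ∫ s in Icc s₀ (2 * s₀), f s ≤ ∫ s in Ioi (0 : ℝ), f s :=
    setIntegral_mono_set hint (ae_of_all _ hnonneg) hsub.eventuallyLE
  have h2 : volume.real (Icc s₀ (2 * s₀)) • (c_w * c_a ^ 3 / (32 * s₀ ^ 3)) ≤ ∫ s in Icc s₀ (2 * s₀), f s :=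
    setIntegral_ge_of_const_le measurableSet_Icc (by rw [Real.volume_Icc]; exact ENNReal.ofReal_ne_top) hwin
      (hint.mono_set hsub)
  have hvol : volume.real (Icc s₀ (2 * s₀)) = s₀ := by
    rw [Real.volume_real_Icc, max_eq_left (by linarith)]; ring
  rw [hvol, smul_eq_mul] at h2
  calc _ = s₀ * (c_w * c_a ^ 3 / (32 * s₀ ^ 3)) := by rw [hs0]; field_simp
    _ ≤ _ := h2.trans h1

end Kernel

/-- **Diagonal floor of the transverse propagator**: there is an absolute constant `c > 0` with
`∑_{k ≠ 0} (ε₀+ε₁)/(ε₀+…+ε₃) cos(2π(k₃-k₂)n/L) ≥ c L⁴/n⁴` for `1 ≤ n`, `8n ≤ L`. -/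
theorem diagSum_ge : ∃ c : ℝ, 0 < c ∧ ∀ (L n : ℕ) [NeZero L], 1 ≤ n → 8 * n ≤ L →
    c * (L : ℝ) ^ 4 / (n : ℝ) ^ 4 ≤
      ∑ k : Fin 4 → ZMod L,
        (if k = 0 then 0 else ((2 - 2 * Real.cos (2 * Real.pi * ((k 0).val : ℝ) / L)) + (2 - 2 * Real.cos (2 * Real.pi * ((k 1).val : ℝ) / L))) /
          ((2 - 2 * Real.cos (2 * Real.pi * ((k 0).val : ℝ) / L)) + (2 - 2 * Real.cos (2 * Real.pi * ((k 1).val : ℝ) / L)) +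
            (2 - 2 * Real.cos (2 * Real.pi * ((k 2).val : ℝ) / L)) + (2 - 2 * Real.cos (2 * Real.pi * ((k 3).val : ℝ) / L)))) *
          Real.cos (2 * Real.pi * (((k 3).val : ℝ) - ((k 2).val : ℝ)) * n / L) := by
  set c_a : ℝ := Real.exp (-1) / (2 * Real.pi) with hca
  set C_d : ℝ := Real.pi ^ 2 * Real.sqrt (2 * Real.pi) / 16 with hCd
  set K₀ : ℝ := 2 * C_d / c_a + 1 with hK0
  set c_w : ℝ := min (1 / (12 * Real.exp 1 * Real.pi ^ 3)) (2 * Real.exp (-(4 * Real.pi ^ 2 * (K₀ / 32))) / Real.pi ^ 3)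
    with hcw
  have hK00 : 0 < K₀ := by rw [hK0]; positivity
  have hcw0 : 0 < c_w := lt_min (by positivity) (by positivity)
  refine ⟨c_w * c_a ^ 3 / (16 * K₀ ^ 2), by positivity, fun L n _ hn hnL => ?_⟩
  have hL : (0 : ℝ) < L := by exact_mod_cast NeZero.pos L
  have hnL' : n < L := by omega
  set ε : ZMod L → ℝ := fun k => 2 - 2 * Real.cos (2 * Real.pi * (k.val : ℝ) / L) with hε'
  set q : ℝ → ZMod L → ℝ := fun s m => (∑ k : ZMod L, Real.exp (-(s * ε k)) *
      Real.cos (2 * Real.pi * (k.val : ℝ) * (m.val : ℝ) / L)) / L with hq'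
  set w : ℝ → ℝ := fun s => (∑ k : ZMod L, ε k * Real.exp (-(s * ε k))) / L with hw'
  have hε : ∀ k, ε k = 2 - 2 * Real.cos (2 * Real.pi * (k.val : ℝ) / L) := fun _ => rfl
  have hq : ∀ s m, q s m = (∑ k : ZMod L, Real.exp (-(s * ε k)) *
      Real.cos (2 * Real.pi * (k.val : ℝ) * (m.val : ℝ) / L)) / L := fun _ _ => rfl
  have hw : ∀ s, w s = (∑ k : ZMod L, ε k * Real.exp (-(s * ε k))) / L := fun _ => rfl
  have hrep := diagSum_eq_integral hε hq hw hnL'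
  have hlow := integral_wqq_ge hε hq hw hn hnL
  simp only [hε'] at hrep
  rw [hrep]
  calc c_w * c_a ^ 3 / (16 * K₀ ^ 2) * (L : ℝ) ^ 4 / (n : ℝ) ^ 4
      = 2 * (L : ℝ) ^ 4 * (c_w * c_a ^ 3 / (32 * K₀ ^ 2 * (n : ℝ) ^ 4)) := by ring
    _ ≤ 2 * (L : ℝ) ^ 4 * ∫ s in Ioi (0 : ℝ), w s * q s 0 * q s (n : ZMod L) ^ 2 := by gcongr

end CycleKernel

/-- **Diagonal floor of the transverse propagator** (registered helper stub `TreeDiagPropagatorFloor` of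
stmt-QuantumFields-9365). -/
theorem TreeDiagPropagatorFloor : ∃ c : ℝ, 0 < c ∧ ∀ (L n : ℕ) [NeZero L], 1 ≤ n → 8 * n ≤ L →
    c * (L : ℝ) ^ 4 / (n : ℝ) ^ 4 ≤
      ∑ k : Fin 4 → ZMod L,
        (if k = 0 then 0 else ((2 - 2 * Real.cos (2 * Real.pi * ((k 0).val : ℝ) / L)) + (2 - 2 * Real.cos (2 * Real.pi * ((k 1).val : ℝ) / L))) /
          ((2 - 2 * Real.cos (2 * Real.pi * ((k 0).val : ℝ) / L)) + (2 - 2 * Real.cos (2 * Real.pi * ((k 1).val : ℝ) / L)) +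
            (2 - 2 * Real.cos (2 * Real.pi * ((k 2).val : ℝ) / L)) + (2 - 2 * Real.cos (2 * Real.pi * ((k 3).val : ℝ) / L)))) *
          Real.cos (2 * Real.pi * (((k 3).val : ℝ) - ((k 2).val : ℝ)) * n / L) :=
  CycleKernel.diagSum_ge

end Summit.QuantumFields.YangMills.Theorems.FemtoCurvatureSkewness

end
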